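import Mathlib
import Summits.Ventures.PercRepro.TriangleCapRowBCornerCap

/-!
# PercRepro — THE CAP ON THE CELL `(k, a, a)` FOR EVERY ROW `a ≥ 5`, THE PIECES: with `a` missing pairs the
non-bipartite gap of the cap graphs is at least `2 (k − a − 3)` — the count, the `R`-sum with deficit `2`, and the
EXACT `N`-sum with its loss term (p3, gen 47; part 200m)

At `r = a` the count `2 (a − 1) K − 2a = 2M + 2P + E` (`K = k − a`, `|R| = a − 1`) with an edge inside `R` is
impossible for every `K ≥ 2a` once the per-vertex degree cap of its ends is fed in (`rowA_noedge`, as at the corner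
of part 200k), so `E = 0`, `(a − 2) M ≤ a` gives `M ≤ 1`, and `M = 1` has `P = (a − 1) K − a − 1`: deficit `2` on
the `R`-sum (`Σ_R d² + 2 (2K − 4) ≤ (a − 1)(K − 1)²`, `rowA_R_sum`), and on `N` the EXACT identity
`d² + g (a − 1 − g) = 1 + 3f + (a + 1) g + 2fg` (`rowA_vertex_identity`): the loss `Σ_N g (a − 1 − g)` is at least
`2 Σ_{f = 0} (a − 1 − g)` (every non-end `y` is missed by at most `2` vertices of `R`, hence `g ≥ a − 3 ≥ 2`), which
is exactly `4` more than the crude bound of part 200f gives away — the `4` by which the crude bound falls short of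
`2 (k − a − 3)` (`rowA_sq_arith`, slack `0`). Axioms: standard.
-/

namespace PercRepro

namespace TriangleCap

namespace C047

open Finset

/-- **THE COUNT AT `r = a` WITH AN EDGE INSIDE `R`:** impossible for `K ≥ 2a` (`a = a' + 5`), with the degree caps
`P_u + d_R(u) ≤ K`, `P_v + d_R(v) ≤ K` of the ends and `d_R ≤ a − 2`. -/
theorem rowA_noedge (a' K M P E m Pu Pv Pr du dv dr : ℕ) (hK : 2 * (a' + 5) ≤ K)
    (hdeg : K + (K + 2 * M + P) + (P + E) = 2 * m) (hm : m + (a' + 5) = (a' + 5) * K)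
    (h1 : P + E ≤ (a' + 4) * K) (hPuv : Pu + Pv ≤ K + 1) (hrest : Pr + (a' + 2) * M ≤ (a' + 2) * K)
    (hP : P = Pu + Pv + Pr) (hE : E = du + dv + dr) (hu : Pu + du ≤ K) (hv : Pv + dv ≤ K)
    (hr : Pr + dr ≤ (a' + 2) * K) (hdu : du ≤ a' + 3) (hdv : dv ≤ a' + 3) : False := by
  subst hP hE
  obtain ⟨t, rfl⟩ : ∃ t, K = 2 * (a' + 5) + t := ⟨K - 2 * (a' + 5), by omega⟩
  nlinarith [hdeg, hm, h1, hPuv, hrest, hu, hv, hr, hdu, hdv, Nat.zero_le (a' * M), Nat.zero_le (t * M),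
    Nat.zero_le (a' * t)]

/-- `(a − 2) M ≤ a` ⇒ `M ≤ 1` (`a ≥ 5`): the count with `E = 0` at `r = a`. -/
theorem rowA_matching (a K M P m : ℕ) (ha : 5 ≤ a) (hdeg : K + (K + 2 * M + P) + (P + 0) = 2 * m)
    (hm : m + a = a * K) (h2 : P + (a - 1) * M ≤ (a - 1) * K) : M ≤ 1 := by
  by_contra hM
  have hM2 : 2 ≤ M := by omega
  obtain ⟨a', rfl⟩ : ∃ a', a = a' + 5 := ⟨a - 5, by omega⟩
  have e : a' + 5 - 1 = a' + 4 := by omega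
  rw [e] at h2
  have hMM : (a' + 3) * 2 ≤ (a' + 3) * M := Nat.mul_le_mul_left _ hM2
  nlinarith [hdeg, hm, h2, hMM]

/-- A vertex of `R` at `P ∈ {K − 3, K − 2, K − 1}`: `P² + (2K − 4)(K − 1) ≤ (K − 1)² + (2K − 4) P`. -/
theorem rowA_R_vertex (P K : ℕ) (hK : 3 ≤ K) (hP1 : P + 1 ≤ K) (hP2 : K ≤ P + 3) :
    P * P + (2 * K - 4) * (K - 1) ≤ (K - 1) * (K - 1) + (2 * K - 4) * P := by
  obtain ⟨t, rfl⟩ : ∃ t, K = t + 3 := ⟨K - 3, by omega⟩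
  have e1 : 2 * (t + 3) - 4 = 2 * t + 2 := by omega
  have e2 : t + 3 - 1 = t + 2 := by omega
  rw [e1, e2]
  rcases Nat.lt_or_ge P (t + 1) with h | h
  · have : P = t := by omega
    subst this
    nlinarith
  · rcases Nat.lt_or_ge P (t + 2) with h' | h'
    · have : P = t + 1 := by omega
      subst this
      nlinarith
    · have : P = t + 2 := by omega
      subst this
      nlinarith

variable {V : Type*} [DecidableEq V]

/-- **THE `R`-SUM AT `M = 1`, `r = a`:** every `u ∈ R` at `≤ K − 1`, `Σ_R degIn N + 2 = |R| (K − 1)` ⇒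
`Σ_R (degIn N)² + 2 (2K − 4) ≤ |R| (K − 1)²` (`K ≥ 3`). -/
theorem rowA_R_sum (D : SimpleGraph V) [DecidableRel D.Adj] (R N : Finset V) (K : ℕ) (hK : 3 ≤ K)
    (hPle : ∀ u ∈ R, degIn D N u + 1 ≤ K) (hsum : ∑ u ∈ R, degIn D N u + 2 = R.card * (K - 1)) :
    ∑ u ∈ R, degIn D N u * degIn D N u + (2 * K - 4) * 2 ≤ R.card * ((K - 1) * (K - 1)) := by
  have hlow : ∀ u ∈ R, K ≤ degIn D N u + 3 := by
    intro u hu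
    have h1 := add_sum_erase R (fun w => degIn D N w) hu
    have h2 : ∑ w ∈ R.erase u, degIn D N w ≤ ∑ _w ∈ R.erase u, (K - 1) :=
      sum_le_sum (fun w hw => by have := hPle w (mem_of_mem_erase hw); omega)
    rw [sum_const, smul_eq_mul, card_erase_of_mem hu] at h2
    have hR1 : 1 ≤ R.card := card_pos.mpr ⟨u, hu⟩
    have e : R.card * (K - 1) = (R.card - 1) * (K - 1) + (K - 1) := by
      obtain ⟨c, hc⟩ : ∃ c, R.card = c + 1 := ⟨R.card - 1, by omega⟩
      rw [hc, Nat.add_sub_cancel, add_mul, one_mul]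
    omega
  have h := sum_le_sum (fun u hu => rowA_R_vertex (degIn D N u) K hK (hPle u hu) (hlow u hu))
  rw [sum_add_distrib, sum_add_distrib, sum_const, sum_const, smul_eq_mul, smul_eq_mul, ← mul_sum] at h
  have e1 : (2 * K - 4) * (∑ u ∈ R, degIn D N u + 2) = (2 * K - 4) * ∑ u ∈ R, degIn D N u + (2 * K - 4) * 2 :=
    mul_add _ _ _
  rw [hsum] at e1
  have e2 : R.card * ((2 * K - 4) * (K - 1)) = (2 * K - 4) * (R.card * (K - 1)) := by ring
  rw [e2] at h
  omega

/-- **THE VERTEX IDENTITY ON `N`:** `f ≤ 1`, `g + 1 ≤ a` ⇒ `(1 + f + g)² + g (a − 1 − g) = 1 + 3f + (a + 1) g + 2fg`. -/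
theorem rowA_vertex_identity (f g a : ℕ) (hf : f ≤ 1) (hg : g + 1 ≤ a) :
    (1 + f + g) * (1 + f + g) + g * (a - 1 - g) = 1 + 3 * f + (a + 1) * g + 2 * (f * g) := by
  obtain ⟨c, hc⟩ : ∃ c, a - 1 - g = c := ⟨_, rfl⟩
  have hac : a = g + c + 1 := by omega
  subst hac
  rw [hc]
  interval_cases f <;> ring

/-- A non-end vertex `y` of `N` (`f = 0`) missed by at most `2` vertices of `R` (`a − 1 − g ≤ 2`, `a ≥ 5`) pays
`g (a − 1 − g) ≥ 2 (a − 1 − g)`. -/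
theorem rowA_loss_vertex (g a : ℕ) (ha : 5 ≤ a) (hg : g + 1 ≤ a) (hmiss : a - 1 - g ≤ 2) :
    2 * (a - 1 - g) ≤ g * (a - 1 - g) := by
  apply Nat.mul_le_mul_right
  omega

/-- **THE ARITHMETIC OF `M = 1` AT `r = a`:** `a ≥ 5`, `K ≥ 2a`, `m + a = aK`, `P + a + 1 + K = aK`,
`S_N ≤ K + 6 + (a + 3) P + 4 (a − 1)` (the refined `N`-sum: `K + 6 + (a + 3) P − 2 (a − 1)(K − 2)`, written without
subtraction), `S_R + 2 (2K − 4) ≤ (a − 1)(K − 1)²` ⇒ `K² + S_N + S_R + a (k − 1 − a) + 2 (k − a − 3) ≤ m k`,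
`k = K + a`; slack `0`. -/
theorem rowA_sq_arith (a K P SN SR m : ℕ) (ha : 5 ≤ a) (hK : 2 * a ≤ K) (hm : m + a = a * K)
    (hP : P + a + 1 + K = a * K) (hSN : SN + 2 * (a - 1) * (K - 2) ≤ K + 6 + (a + 3) * P)
    (hSR : SR + (2 * K - 4) * 2 ≤ (a - 1) * ((K - 1) * (K - 1))) :
    K * K + SN + SR + a * (K + a - 1 - a) + 2 * (K + a - a - 3) ≤ m * (K + a) := by
  obtain ⟨q, rfl⟩ : ∃ q, a = q + 5 := ⟨a - 5, by omega⟩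
  obtain ⟨t, rfl⟩ : ∃ t, K = 2 * (q + 5) + t := ⟨K - 2 * (q + 5), by omega⟩
  have e1 : 2 * (q + 5) + t + (q + 5) - 1 - (q + 5) = 2 * q + t + 9 := by omega
  have e2 : 2 * (q + 5) + t + (q + 5) - (q + 5) - 3 = 2 * q + t + 7 := by omega
  have e3 : q + 5 - 1 = q + 4 := by omega
  have e4 : 2 * (q + 5) + t - 2 = 2 * q + t + 8 := by omega
  have e5 : 2 * (q + 5) + t - 1 = 2 * q + t + 9 := by omega
  have e6 : 2 * (2 * (q + 5) + t) - 4 = 4 * q + 2 * t + 16 := by omega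
  rw [e1, e2]
  rw [e3, e4] at hSN
  rw [e3, e5, e6] at hSR
  have hm' : m = 2 * q * q + 19 * q + q * t + 5 * t + 45 := by ring_nf at hm ⊢; omega
  have hP' : P = 2 * q * q + 17 * q + q * t + 4 * t + 34 := by ring_nf at hP ⊢; omega
  subst hm' hP'
  nlinarith [hSN, hSR]

end C047

end TriangleCap

end PercRepro
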